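import Mathlib
import HarnessLib
import Summits.PneNP.PneNP.Theorems.CnfIdealGenLengthFregeShortensGenLengthBool

/-!
# `FregeShortensGenLength` (stmt-PneNP-18886) — Part C: evaluation at Boolean points and the rule step

* `repr_leafProd_mul_leaf`, `repr_leafProd_mul_trForm`: for a Boolean-like leaf assignment `w` (degrees `≤ s`,
  idempotency defects and commutators few-term) and a point indicator `leafProd w ρ` covering the variables of
  `B` with the Booleans `z`, `leafProd w ρ · tr_w(B) ≡ [B false at z] · leafProd w ρ` modulo few terms;
* `split_aux` / `ruleStep`: for a SOUND rule scheme `r` there is a constant `K` (depending on `r` only) such that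
  every substitution instance of `r` by formulas of size `≤ s` satisfies
  `tr(conclusion σ) = ∑_j a_j · tr(premise_j σ) + (≤ K s² single terms of cofactor degree ≤ K s)` with LEFT
  coefficients `wordDeg a_j ≤ K s` — split `1 = ∏_i (w_i + (1 - w_i))` over the rule's metavariables and, at each
  of the `2^k` Boolean points, use soundness: the conclusion is true there (`≡ 0`) or some premise is false there
  (`leafProd ≡ leafProd · tr(premise)`).
-/

set_option linter.dupNamespace false -- `Summit.PneNP.PneNP.…`: summit = sub-problem name (D-0017)

/-! ## Part C — evaluation at Boolean points and the rule step -/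

namespace Summit.PneNP.PneNP.Theorems.CnfIdealGenLength

open Literature.Computability.Complexity
open Literature.Computability.MetaComplexity
open Literature.Computability.MetaComplexity.NCIPS

noncomputable section

variable {R : Type*} [CommRing R]

section Eval

variable {ν : Type*} (w : ℕ → MonoidAlgebra R (FreeMonoid ν)) (V : Finset ℕ) (s : ℕ)

/-- A literal factor commutes with a leaf up to one commutator's worth of terms. [folklore] -/
theorem repr_leafLit_comm
    (hcomm : ∀ i ∈ V, ∀ j ∈ V, Repr R (2 * s) (s ^ 2) (w i * w j - w j * w i))
    {l : ℕ × Bool} (hl : l.1 ∈ V) {i : ℕ} (hi : i ∈ V) :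
    Repr R (2 * s) (s ^ 2) (leafLit w l * w i - w i * leafLit w l) := by
  unfold leafLit
  split_ifs
  · exact (hcomm l.1 hl i hi).neg.congr (by noncomm_ring)
  · exact hcomm l.1 hl i hi

/-- **Evaluation of a leaf at a point indicator**: if `(i, b)` occurs in `ρ` then
`leafProd w ρ · w_i ≡ [b = false] · leafProd w ρ` modulo at most `|ρ| · s²` single terms of cofactor degree
`≤ 2 |ρ| s` (commute `w_i` leftwards to its own factor, then use `w_i² ≡ w_i`). [folklore] -/
theorem repr_leafProd_mul_leaf
    (hdeg : ∀ i ∈ V, wordDeg (w i) ≤ s)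
    (hbool : ∀ i ∈ V, Repr R (2 * s) (s ^ 2) (w i * w i - w i))
    (hcomm : ∀ i ∈ V, ∀ j ∈ V, Repr R (2 * s) (s ^ 2) (w i * w j - w j * w i))
    {ρ : List (ℕ × Bool)} (hρ : ∀ l ∈ ρ, l.1 ∈ V) {i : ℕ} {b : Bool} (hib : (i, b) ∈ ρ) :
    Repr R (2 * ρ.length * s) (ρ.length * s ^ 2)
      (leafProd w ρ * w i - cond b 0 1 * leafProd w ρ) := by
  induction ρ with
  | nil => simp at hib
  | cons l ρ ih =>
    have hρ' : ∀ l' ∈ ρ, l'.1 ∈ V := fun l' hl' => hρ l' (List.mem_cons_of_mem _ hl')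
    have hdegρ : wordDeg (leafProd w ρ) ≤ ρ.length * s :=
      wordDeg_leafProd_le w ρ fun l' hl' => hdeg _ (hρ' l' hl')
    have hl : l.1 ∈ V := hρ l (by simp)
    have h0 : 0 ≤ ρ.length * s := Nat.zero_le _
    have h0' : 0 ≤ ρ.length * s ^ 2 := Nat.zero_le _
    rw [List.length_cons, leafProd_cons]
    rcases List.mem_cons.1 hib with h | h
    · subst h
      have hb := (hbool i hl).mul_left hdegρ
      cases b
      · simp only [leafLit, cond_false, Bool.false_eq_true, ↓reduceIte]
        refine (hb.congr (by noncomm_ring)).mono ?_ ?_ <;> nlinarith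
      · simp only [leafLit, cond_true, ↓reduceIte]
        refine (hb.neg.congr (by noncomm_ring)).mono ?_ ?_ <;> nlinarith
    · have hi : i ∈ V := hρ (i, b) hib
      have h1 := ((repr_leafLit_comm w V s hcomm hl hi).mul_left hdegρ).mono
        (show ρ.length * s + 2 * s ≤ 2 * (ρ.length + 1) * s by nlinarith) le_rfl
      have h2 := ((ih hρ' h).mul_right (wordDeg_leafLit_le w l (hdeg _ hl))).mono
        (show 2 * ρ.length * s + s ≤ 2 * (ρ.length + 1) * s by nlinarith) le_rfl
      refine ((h1.add h2).congr (by noncomm_ring)).mono le_rfl ?_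
      nlinarith

/-- Word degree of the constants `cond b 0 1`. [folklore] -/
theorem wordDeg_cond_le (b : Bool) : wordDeg (cond b (0 : MonoidAlgebra R (FreeMonoid ν)) 1) ≤ 0 := by
  cases b <;> simp

/-- **Evaluation of a formula at a point indicator**: if every variable `i` of `B` occurs in `ρ` with the
Boolean `z i`, then `leafProd w ρ · tr_w(B) ≡ [B false at z] · leafProd w ρ` modulo at most
`size B · |ρ| · s²` single terms of cofactor degree `≤ (2|ρ| + size B) s`. [folklore] -/
theorem repr_leafProd_mul_trForm
    (hdeg : ∀ i ∈ V, wordDeg (w i) ≤ s)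
    (hbool : ∀ i ∈ V, Repr R (2 * s) (s ^ 2) (w i * w i - w i))
    (hcomm : ∀ i ∈ V, ∀ j ∈ V, Repr R (2 * s) (s ^ 2) (w i * w j - w j * w i))
    {ρ : List (ℕ × Bool)} (hρ : ∀ l ∈ ρ, l.1 ∈ V) (z : ℕ → Bool) (B : PropForm ℕ)
    (hB : ∀ i ∈ B.vars, (i, z i) ∈ ρ) :
    Repr R (2 * ρ.length * s + B.size * s) (B.size * (ρ.length * s ^ 2))
      (leafProd w ρ * trForm w B - cond (B.eval z) 0 1 * leafProd w ρ) := by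
  have h0 : 0 ≤ ρ.length * s := Nat.zero_le _
  have h0' : 0 ≤ ρ.length * s ^ 2 := Nat.zero_le _
  induction B with
  | var i =>
    simp only [trForm_var, PropForm.eval, PropForm.size]
    exact (repr_leafProd_mul_leaf w V s hdeg hbool hcomm hρ (hB i (by simp [PropForm.vars]))).mono
      (by omega) (by omega)
  | const b =>
    cases b <;> simp only [trForm_const, PropForm.eval, PropForm.size, cond_true, cond_false,
      Bool.false_eq_true, ↓reduceIte] <;> exact Repr.zero.congr (by noncomm_ring)
  | neg C ih =>
    have ih' := ih fun i hi => hB i (by simpa [PropForm.vars] using hi)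
    simp only [trForm_neg, PropForm.eval, PropForm.size]
    cases hc : PropForm.eval z C <;>
      simp only [hc, Bool.not_false, Bool.not_true, cond_true, cond_false] at ih' ⊢ <;>
      refine (ih'.neg.congr (by noncomm_ring)).mono (by nlinarith) (by nlinarith)
  | conj C D ihC ihD =>
    have ihC' := ihC fun i hi => hB i (by simp [PropForm.vars, hi])
    have ihD' := ihD fun i hi => hB i (by simp [PropForm.vars, hi])
    have hdD : wordDeg (1 - trForm w D) ≤ D.size * s :=
      wordDeg_one_sub_le (wordDeg_trForm_le w D fun i hi => hdeg i (hρ _ (hB i (by simp [PropForm.vars, hi]))))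
    simp only [trForm_conj, PropForm.eval, PropForm.size]
    have key := ((ihC'.mul_right hdD).mono
      (show 2 * ρ.length * s + C.size * s + D.size * s ≤ 2 * ρ.length * s + (C.size + D.size + 1) * s by
        nlinarith) le_rfl).add
      ((ihD'.mul_left (wordDeg_one_sub_le (wordDeg_cond_le (R := R) (ν := ν) (PropForm.eval z C)))).mono
      (show 0 + (2 * ρ.length * s + D.size * s) ≤ 2 * ρ.length * s + (C.size + D.size + 1) * s by
        nlinarith) le_rfl)
    cases hc : PropForm.eval z C <;> cases hd : PropForm.eval z D <;>
      simp only [hc, hd, Bool.and_true, Bool.and_false, cond_true, cond_false] at key ⊢ <;>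
      refine (key.congr (by noncomm_ring)).mono le_rfl (by nlinarith)
  | disj C D ihC ihD =>
    have ihC' := ihC fun i hi => hB i (by simp [PropForm.vars, hi])
    have ihD' := ihD fun i hi => hB i (by simp [PropForm.vars, hi])
    have hdD : wordDeg (trForm w D) ≤ D.size * s :=
      wordDeg_trForm_le w D fun i hi => hdeg i (hρ _ (hB i (by simp [PropForm.vars, hi])))
    simp only [trForm_disj, PropForm.eval, PropForm.size]
    have key := ((ihC'.mul_right hdD).mono
      (show 2 * ρ.length * s + C.size * s + D.size * s ≤ 2 * ρ.length * s + (C.size + D.size + 1) * s by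
        nlinarith) le_rfl).add
      ((ihD'.mul_left (wordDeg_cond_le (R := R) (ν := ν) (PropForm.eval z C))).mono
      (show 0 + (2 * ρ.length * s + D.size * s) ≤ 2 * ρ.length * s + (C.size + D.size + 1) * s by
        nlinarith) le_rfl)
    cases hc : PropForm.eval z C <;> cases hd : PropForm.eval z D <;>
      simp only [hc, hd, Bool.or_true, Bool.or_false, cond_true, cond_false] at key ⊢ <;>
      refine (key.congr (by noncomm_ring)).mono le_rfl (by nlinarith)

end Eval

section RuleStep

/-- The variables of a rule scheme (conclusion and all premises). [folklore] -/
theorem vars_subset_ruleVars_conclusion (r : FregeRule) :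
    r.conclusion.vars ⊆ r.conclusion.vars ∪ r.premises.toFinset.biUnion PropForm.vars :=
  Finset.subset_union_left

/-- The variables of a premise are among the variables of the rule. [folklore] -/
theorem vars_subset_ruleVars_premise (r : FregeRule) {p : PropForm ℕ} (hp : p ∈ r.premises) :
    p.vars ⊆ r.conclusion.vars ∪ r.premises.toFinset.biUnion PropForm.vars :=
  (Finset.subset_biUnion_of_mem PropForm.vars (List.mem_toFinset.2 hp)).trans Finset.subset_union_right

/-- **Splitting recursion.** Fix a sound rule, a Boolean-like leaf assignment `w` on its variables `V`,
and targets `t j` (`j < k`) among which every translated premise occurs. For every partial point `ρ`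
and list `L` of variables still to be split (`ρ`, `L` covering `V`), `leafProd w ρ · tr_w(conclusion)`
is a LEFT combination `∑_{j<k} a_j t_j` with `wordDeg a_j ≤ κ s` plus at most `2^{|L|} · 2κ² s²` single
terms of cofactor degree `≤ 3κ s`: at a total point the conclusion is either true (`≡ 0`) or, by
soundness, some premise is false there and `leafProd ≡ leafProd · tr(premise)`; otherwise split
`leafProd ρ = leafProd ((i,false)::ρ) + leafProd ((i,true)::ρ)`. [folklore] -/
theorem split_aux {n : ℕ} (r : FregeRule) (hr : r.IsSound) (w : ℕ → MonoidAlgebra R (FreeMonoid (Fin n)))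
    (s κ k : ℕ) (t : ℕ → MonoidAlgebra R (FreeMonoid (Fin n)))
    (hdeg : ∀ i ∈ r.conclusion.vars ∪ r.premises.toFinset.biUnion PropForm.vars, wordDeg (w i) ≤ s)
    (hbool : ∀ i ∈ r.conclusion.vars ∪ r.premises.toFinset.biUnion PropForm.vars,
      Repr R (2 * s) (s ^ 2) (w i * w i - w i))
    (hcomm : ∀ i ∈ r.conclusion.vars ∪ r.premises.toFinset.biUnion PropForm.vars,
      ∀ j ∈ r.conclusion.vars ∪ r.premises.toFinset.biUnion PropForm.vars,
        Repr R (2 * s) (s ^ 2) (w i * w j - w j * w i))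
    (hκc : r.conclusion.size ≤ κ) (hκp : ∀ p ∈ r.premises, p.size ≤ κ)
    (ht : ∀ p ∈ r.premises, ∃ j < k, t j = trForm w p)
    (L : List ℕ) (ρ : List (ℕ × Bool))
    (hρ : ∀ l ∈ ρ, l.1 ∈ r.conclusion.vars ∪ r.premises.toFinset.biUnion PropForm.vars)
    (hL : ∀ i ∈ L, i ∈ r.conclusion.vars ∪ r.premises.toFinset.biUnion PropForm.vars)
    (hcov : ∀ v ∈ r.conclusion.vars ∪ r.premises.toFinset.biUnion PropForm.vars, v ∈ L ∨ ∃ b, (v, b) ∈ ρ)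
    (hlen : ρ.length + L.length ≤ κ) :
    ∃ a : ℕ → MonoidAlgebra R (FreeMonoid (Fin n)), (∀ j, wordDeg (a j) ≤ κ * s) ∧
      Repr R (3 * κ * s) (2 ^ L.length * (2 * κ ^ 2 * s ^ 2))
        (leafProd w ρ * trForm w r.conclusion - ∑ j ∈ Finset.range k, a j * t j) := by
  induction L generalizing ρ with
  | nil =>
    -- a total point: read off the Boolean point `z` from `ρ`
    set V := r.conclusion.vars ∪ r.premises.toFinset.biUnion PropForm.vars with hV
    let z : ℕ → Bool := fun v => decide ((v, true) ∈ ρ)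
    have hz : ∀ v ∈ V, (v, z v) ∈ ρ := by
      intro v hv
      rcases hcov v hv with h | ⟨b, hb⟩
      · simp at h
      · by_cases ht' : (v, true) ∈ ρ
        · have : z v = true := by simp [z, ht']
          rwa [this]
        · have : z v = false := by simp [z, ht']
          rw [this]
          cases b
          · exact hb
          · exact absurd hb ht'
    have hlenρ : ρ.length ≤ κ := by simpa using hlen
    have hdegρ : wordDeg (leafProd w ρ) ≤ κ * s :=
      (wordDeg_leafProd_le w ρ fun l hl => hdeg _ (hρ l hl)).trans (Nat.mul_le_mul_right _ hlenρ)
    have h0 : 0 ≤ ρ.length * s := Nat.zero_le _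
    have h0' : 0 ≤ ρ.length * s ^ 2 := Nat.zero_le _
    have hs0 : 0 ≤ s := Nat.zero_le _
    have hevc := (repr_leafProd_mul_trForm w V s hdeg hbool hcomm hρ z r.conclusion
      (fun i hi => hz i (vars_subset_ruleVars_conclusion r hi))).mono
      (show 2 * ρ.length * s + r.conclusion.size * s ≤ 3 * κ * s by nlinarith)
      (show r.conclusion.size * (ρ.length * s ^ 2) ≤ κ ^ 2 * s ^ 2 by nlinarith [Nat.mul_le_mul hκc hlenρ])
    cases hc : PropForm.eval z r.conclusion
    · -- conclusion false at `z`: some premise is false at `z`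
      have hp : ∃ p ∈ r.premises, PropForm.eval z p = false := by
        by_contra hne
        have hall : ∀ p ∈ r.premises, PropForm.eval z p = true := fun p hp => by
          cases hpz : PropForm.eval z p
          · exact absurd ⟨p, hp, hpz⟩ hne
          · rfl
        have := hr z hall
        rw [hc] at this
        exact Bool.false_ne_true this
      obtain ⟨p, hpm, hpz⟩ := hp
      obtain ⟨j₀, hj₀, htj₀⟩ := ht p hpm
      have hevp := (repr_leafProd_mul_trForm w V s hdeg hbool hcomm hρ z p
        (fun i hi => hz i (vars_subset_ruleVars_premise r hpm hi))).mono
        (show 2 * ρ.length * s + p.size * s ≤ 3 * κ * s by nlinarith [hκp p hpm])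
        (show p.size * (ρ.length * s ^ 2) ≤ κ ^ 2 * s ^ 2 by nlinarith [Nat.mul_le_mul (hκp p hpm) hlenρ])
      rw [hpz] at hevp
      simp only [hc, cond_false] at hevc hevp
      refine ⟨fun j => if j = j₀ then leafProd w ρ else 0, fun j => ?_, ?_⟩
      · show wordDeg (if j = j₀ then leafProd w ρ else 0) ≤ κ * s
        split_ifs
        · exact hdegρ
        · simp
      · simp only [ite_mul, zero_mul, Finset.sum_ite_eq', Finset.mem_range, hj₀, ↓reduceIte, htj₀,
          List.length_nil, pow_zero, one_mul]
        exact ((hevc.sub hevp).congr (by noncomm_ring)).mono le_rfl (le_of_eq (by ring))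
    · -- conclusion true at `z`
      simp only [hc, cond_true, zero_mul, sub_zero] at hevc
      refine ⟨fun _ => 0, fun _ => by simp, ?_⟩
      simp only [zero_mul, Finset.sum_const_zero, sub_zero, List.length_nil, pow_zero, one_mul]
      exact hevc.mono le_rfl (by nlinarith)
  | cons i L ih =>
    have hi : i ∈ r.conclusion.vars ∪ r.premises.toFinset.biUnion PropForm.vars := hL i (by simp)
    have hL' : ∀ i' ∈ L, i' ∈ r.conclusion.vars ∪ r.premises.toFinset.biUnion PropForm.vars :=
      fun i' hi' => hL i' (by simp [hi'])
    have hyp : ∀ b : Bool, ∃ a : ℕ → MonoidAlgebra R (FreeMonoid (Fin n)), (∀ j, wordDeg (a j) ≤ κ * s) ∧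
        Repr R (3 * κ * s) (2 ^ L.length * (2 * κ ^ 2 * s ^ 2))
          (leafProd w ((i, b) :: ρ) * trForm w r.conclusion - ∑ j ∈ Finset.range k, a j * t j) := by
      intro b
      refine ih ((i, b) :: ρ) ?_ hL' ?_ ?_
      · intro l hl
        rcases List.mem_cons.1 hl with rfl | hl
        · exact hi
        · exact hρ l hl
      · intro v hv
        rcases hcov v hv with h | ⟨b', hb'⟩
        · rcases List.mem_cons.1 h with rfl | h
          · exact Or.inr ⟨b, by simp⟩
          · exact Or.inl h
        · exact Or.inr ⟨b', List.mem_cons_of_mem _ hb'⟩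
      · simp only [List.length_cons] at hlen ⊢
        omega
    obtain ⟨a₀, ha₀, h₀⟩ := hyp false
    obtain ⟨a₁, ha₁, h₁⟩ := hyp true
    refine ⟨fun j => a₀ j + a₁ j, fun j => wordDeg_add_le_of_le (ha₀ j) (ha₁ j), ?_⟩
    have hsplit : leafProd w ρ * trForm w r.conclusion =
        leafProd w ((i, false) :: ρ) * trForm w r.conclusion +
          leafProd w ((i, true) :: ρ) * trForm w r.conclusion := by
      rw [leafProd_cons, leafProd_cons, ← add_mul, ← mul_add, leafLit_false_add_true, mul_one]
    rw [hsplit]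
    refine ((h₀.add h₁).congr ?_).mono le_rfl (by rw [List.length_cons, pow_succ]; ring_nf; omega)
    simp only [add_mul, Finset.sum_add_distrib]
    abel

/-- **Rule step.** For a sound rule scheme `r` there is a constant `K` such that for every substitution
instance of `r` whose metavariables receive formulas of size `≤ s`, and any targets `t j` (`j < k`) among
which the translated premise instances occur, the translated conclusion instance is a left combination
`∑_{j<k} a_j t_j` (`wordDeg a_j ≤ K s`) plus at most `K s²` single terms of cofactor degree `≤ K s`.
The bound is monotone in `K`. [folklore] -/
theorem ruleStep (r : FregeRule) (hr : r.IsSound) : ∃ K : ℕ, ∀ K', K ≤ K' →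
    ∀ (n s k : ℕ) (σ : ℕ → PropForm ℕ) (t : ℕ → MonoidAlgebra R (FreeMonoid (Fin n))),
      (∀ i ∈ r.conclusion.vars ∪ r.premises.toFinset.biUnion PropForm.vars, (σ i).size ≤ s) →
      (∀ p ∈ r.premises, ∃ j < k, t j = trForm (stdLeaf R n) (p.subst σ)) →
      ∃ a : ℕ → MonoidAlgebra R (FreeMonoid (Fin n)), (∀ j, wordDeg (a j) ≤ K' * s) ∧
        Repr R (K' * s) (K' * s ^ 2)
          (trForm (stdLeaf R n) (r.conclusion.subst σ) - ∑ j ∈ Finset.range k, a j * t j) := by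
  set V := r.conclusion.vars ∪ r.premises.toFinset.biUnion PropForm.vars with hV
  set κ := V.card + r.conclusion.size + (r.premises.map PropForm.size).sum with hκ
  refine ⟨3 * κ + 2 ^ κ * (2 * κ ^ 2), fun K' hK' n s k σ t hσ ht => ?_⟩
  set w : ℕ → MonoidAlgebra R (FreeMonoid (Fin n)) := fun i => trForm (stdLeaf R n) (σ i) with hw
  have hdeg : ∀ i ∈ V, wordDeg (w i) ≤ s := fun i hi =>
    (wordDeg_trForm_stdLeaf_le (σ i)).trans (hσ i hi)
  have hbool : ∀ i ∈ V, Repr R (2 * s) (s ^ 2) (w i * w i - w i) := fun i hi =>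
    (repr_bool (σ i)).mono (by have := hσ i hi; omega) (Nat.pow_le_pow_left (hσ i hi) 2)
  have hcomm : ∀ i ∈ V, ∀ j ∈ V, Repr R (2 * s) (s ^ 2) (w i * w j - w j * w i) := fun i hi j hj =>
    (repr_comm (σ i) (σ j)).mono (by have := hσ i hi; have := hσ j hj; omega)
      (by rw [pow_two]; exact Nat.mul_le_mul (hσ i hi) (hσ j hj))
  have hκc : r.conclusion.size ≤ κ := by omega
  have hκp : ∀ p ∈ r.premises, p.size ≤ κ := fun p hp => by
    have := List.le_sum_of_mem (List.mem_map_of_mem (f := PropForm.size) hp)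
    omega
  have ht' : ∀ p ∈ r.premises, ∃ j < k, t j = trForm w p := fun p hp => by
    obtain ⟨j, hj, hje⟩ := ht p hp
    exact ⟨j, hj, by rw [hje, trForm_subst]⟩
  obtain ⟨a, ha, hrepr⟩ := split_aux r hr w s κ k t hdeg hbool hcomm hκc hκp ht' V.toList []
    (by simp) (fun i hi => Finset.mem_toList.1 hi) (fun v hv => Or.inl (Finset.mem_toList.2 hv))
    (by simp only [List.length_nil, Finset.length_toList]; omega)
  have hKκ : κ ≤ K' := by omega
  refine ⟨a, fun j => (ha j).trans (Nat.mul_le_mul_right _ hKκ), ?_⟩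
  rw [trForm_subst, ← hw]
  rw [leafProd_nil, one_mul, Finset.length_toList] at hrepr
  refine hrepr.mono (Nat.mul_le_mul_right _ (by omega)) ?_
  calc 2 ^ V.card * (2 * κ ^ 2 * s ^ 2) ≤ 2 ^ κ * (2 * κ ^ 2 * s ^ 2) :=
        Nat.mul_le_mul_right _ (Nat.pow_le_pow_right (by norm_num) (by omega))
    _ = (2 ^ κ * (2 * κ ^ 2)) * s ^ 2 := by ring
    _ ≤ K' * s ^ 2 := Nat.mul_le_mul_right _ (by omega)

end RuleStep

end

end Summit.PneNP.PneNP.Theorems.CnfIdealGenLength
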